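import Literature.Probability.RandomPlanarGeometry.PolygonalDomains
import Mathlib.Analysis.Complex.Convex
import Mathlib.Analysis.Complex.ReImTopology
import Mathlib.Topology.Algebra.Module.FiniteDimension
import HarnessLib

/-!
# Rectilinear simple closed polygons: the local grid structure of the inside

Support file (plane geometry, [folklore]) for the polyomino approximation of the Jordan domain
`polygonDomain l h` (`PolygonalDomains.lean`) of a simple closed polygon `l` that is
**rectilinear** in the coordinates of a real-linear automorphism `σ` of `ℂ`: consecutive
vertices share their `σ`-abscissa or their `σ`-ordinate (for `σ = 1` this is the usual notion;
stating everything for a general `σ : ℂ ≃L[ℝ] ℂ` gives the reflected / transposed statements for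
free). Write `P` for the inside, `A = closure P`, and call a real number a *vertex abscissa*
(*ordinate*) if it is `(σ v).re` (`(σ v).im`) for a vertex `v`. Everything rests on two facts:
the frontier of `P` is the union of the closed edges (`frontier_polygonDomain`), each of which is
a `σ`-horizontal or `σ`-vertical segment with vertex coordinates; and two distinct closed edges
meet only at a common vertex (`IsSimpleClosedPolygon.eq_or_eq_of_mem_segment`).

* `IsSimpleClosedPolygon.probe` — if `p ∈ A`, `q ∉ A` have the same ordinate, some vertex
  abscissa lies between their abscissae and differs from that of `q` (the segment `[p, q]`
  crosses an edge);
* `IsSimpleClosedPolygon.box_subset_or_subset` — an open coordinate box containing no vertex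
  abscissa / ordinate line lies in `P` or in `Aᶜ`;
* with a **grid gap** `g` (two vertex abscissae, or two ordinates, at distance `< g` are equal):
  `IsSimpleClosedPolygon.mem_closure_of_between` (a horizontal segment of length `< g` with both
  endpoints in `A` lies in `A`), `IsSimpleClosedPolygon.no_cross` (the frontier contains no cross
  of size `< g` centred at a grid point: a vertex is an endpoint of exactly two edges) and the
  **pinch exclusion** `IsSimpleClosedPolygon.pinch` (near a grid point, `A` cannot occupy two
  opposite quadrants while missing points of the two others).

No new definitions; the rectilinearity and gap hypotheses are carried explicitly.
-/

noncomputable section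

open Set Complex

namespace Literature.Probability.RandomPlanarGeometry

/-! ### Axis-parallel segments and coordinate boxes -/

/-- A segment lies in the axis-parallel rectangle spanned by its endpoints. [folklore] -/
theorem segment_subset_rectangle (a b : ℂ) : segment ℝ a b ⊆ Rectangle a b := by
  rw [rectangle_eq_convexHull, ← convexHull_pair]
  refine convexHull_mono ?_
  intro x hx
  simp only [mem_insert_iff, mem_singleton_iff] at hx ⊢
  tauto

/-- The coordinates of a point of a segment lie between those of its endpoints. [folklore] -/
theorem re_im_mem_uIcc_of_mem_segment {a b z : ℂ} (hz : z ∈ segment ℝ a b) :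
    z.re ∈ uIcc a.re b.re ∧ z.im ∈ uIcc a.im b.im :=
  mem_reProdIm.1 (segment_subset_rectangle a b hz)

/-- A vertical or horizontal segment is the (degenerate) rectangle spanned by its endpoints.
[folklore] -/
theorem segment_eq_rectangle {a b : ℂ} (hab : a.re = b.re ∨ a.im = b.im) :
    segment ℝ a b = Rectangle a b := by
  rw [rectangle_eq_convexHull, ← convexHull_pair]
  congr 1
  rcases hab with hab | hab
  · have e1 : (a.re : ℂ) + b.im * I = b := by rw [hab, re_add_im]
    have e2 : (b.re : ℂ) + a.im * I = a := by rw [← hab, re_add_im]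
    rw [e1, e2]
    ext x
    simp only [mem_insert_iff, mem_singleton_iff]
    tauto
  · have e1 : (a.re : ℂ) + b.im * I = a := by rw [← hab, re_add_im]
    have e2 : (b.re : ℂ) + a.im * I = b := by rw [hab, re_add_im]
    rw [e1, e2]
    ext x
    simp only [mem_insert_iff, mem_singleton_iff]
    tauto

/-- Membership in an axis-parallel segment from the coordinates. [folklore] -/
theorem mem_segment_of_re_im {a b z : ℂ} (hab : a.re = b.re ∨ a.im = b.im)
    (hre : z.re ∈ uIcc a.re b.re) (him : z.im ∈ uIcc a.im b.im) : z ∈ segment ℝ a b := by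
  rw [segment_eq_rectangle hab]
  exact mem_reProdIm.2 ⟨hre, him⟩

/-- A point of a half-closed-half-open description of a closed segment: it lies on the
half-open segment or is the far endpoint. [folklore] -/
theorem mem_icoSegment_or_eq_of_mem_segment {x y z : ℂ} (hz : z ∈ segment ℝ x y) :
    z ∈ icoSegment x y ∨ z = y := by
  rw [segment_eq_image_lineMap] at hz
  obtain ⟨θ, ⟨h0, h1⟩, rfl⟩ := hz
  rcases h1.lt_or_eq with h1 | rfl
  · exact Or.inl ⟨θ, ⟨h0, h1⟩, rfl⟩
  · exact Or.inr (AffineMap.lineMap_apply_one x y)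

section Sigma

variable (σ : ℂ ≃L[ℝ] ℂ)

/-- A real-linear automorphism maps segments to segments. [folklore] -/
theorem image_segment_equiv (a b : ℂ) : σ '' segment ℝ a b = segment ℝ (σ a) (σ b) := by
  have := image_segment ℝ ((σ : ℂ →L[ℝ] ℂ) : ℂ →ₗ[ℝ] ℂ).toAffineMap a b
  simpa using this

/-- `σ`-coordinates along a segment lie between those of the endpoints. [folklore] -/
theorem re_im_apply_mem_uIcc_of_mem_segment {a b z : ℂ} (hz : z ∈ segment ℝ a b) :
    (σ z).re ∈ uIcc (σ a).re (σ b).re ∧ (σ z).im ∈ uIcc (σ a).im (σ b).im := by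
  apply re_im_mem_uIcc_of_mem_segment
  rw [← image_segment_equiv]
  exact mem_image_of_mem σ hz

/-- Membership in a `σ`-axis-parallel segment from the `σ`-coordinates. [folklore] -/
theorem mem_segment_of_re_im_apply {a b z : ℂ}
    (hab : (σ a).re = (σ b).re ∨ (σ a).im = (σ b).im)
    (hre : (σ z).re ∈ uIcc (σ a).re (σ b).re) (him : (σ z).im ∈ uIcc (σ a).im (σ b).im) :
    z ∈ segment ℝ a b := by
  have : σ z ∈ σ '' segment ℝ a b := by
    rw [image_segment_equiv]
    exact mem_segment_of_re_im hab hre him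
  obtain ⟨w, hw, hwz⟩ := this
  rwa [← σ.injective hwz]

/-- A point is determined by its `σ`-coordinates. [folklore] -/
theorem eq_of_re_im_apply {z w : ℂ} (hre : (σ z).re = (σ w).re) (him : (σ z).im = (σ w).im) :
    z = w :=
  σ.injective (Complex.ext hre him)

/-- A coordinate box (preimage of `s ×ℂ t` under `σ`) with convex sides is preconnected.
[folklore] -/
theorem isPreconnected_preimage_reProdIm {s t : Set ℝ} (hs : Convex ℝ s) (ht : Convex ℝ t) :
    IsPreconnected (σ ⁻¹' (s ×ℂ t)) := by
  have hc : Convex ℝ (s ×ℂ t) := (hs.linear_preimage reLm).inter (ht.linear_preimage imLm)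
  exact (hc.linear_preimage ((σ : ℂ →L[ℝ] ℂ) : ℂ →ₗ[ℝ] ℂ)).isPreconnected

/-- The closure of an open coordinate box is the closed box. [folklore] -/
theorem closure_preimage_box {a b c d : ℝ} (hab : a < b) (hcd : c < d) :
    closure (σ ⁻¹' (Ioo a b ×ℂ Ioo c d)) = σ ⁻¹' (Icc a b ×ℂ Icc c d) := by
  have e := σ.toHomeomorph.preimage_closure (Ioo a b ×ℂ Ioo c d)
  rw [ContinuousLinearEquiv.coe_toHomeomorph] at e
  rw [← e, closure_reProdIm, closure_Ioo hab.ne, closure_Ioo hcd.ne]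

/-- A point whose `σ`-coordinates lie in the closed box is in the closure of the open box.
[folklore] -/
theorem mem_closure_preimage_box {a b c d : ℝ} (hab : a < b) (hcd : c < d) {z : ℂ}
    (h1 : a ≤ (σ z).re) (h2 : (σ z).re ≤ b) (h3 : c ≤ (σ z).im) (h4 : (σ z).im ≤ d) :
    z ∈ closure (σ ⁻¹' (Ioo a b ×ℂ Ioo c d)) := by
  rw [closure_preimage_box σ hab hcd]
  exact mem_reProdIm.2 ⟨⟨h1, h2⟩, ⟨h3, h4⟩⟩

/-- **Transposition of the coordinates** as a real-linear automorphism of `ℂ`. [folklore] -/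
theorem exists_swap_equiv : ∃ τ : ℂ ≃L[ℝ] ℂ, ∀ z, τ z = ⟨z.im, z.re⟩ := by
  let e : ℂ ≃ₗ[ℝ] ℂ :=
    { toFun := fun z ↦ ⟨z.im, z.re⟩
      invFun := fun z ↦ ⟨z.im, z.re⟩
      map_add' := fun z w ↦ Complex.ext (by simp) (by simp)
      map_smul' := fun r z ↦ Complex.ext (by simp) (by simp)
      left_inv := fun z ↦ Complex.ext (by simp) (by simp)
      right_inv := fun z ↦ Complex.ext (by simp) (by simp) }
  exact ⟨e.toContinuousLinearEquiv, fun z ↦ rfl⟩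

/-- **Reflection in the ordinate axis** as a real-linear automorphism of `ℂ`. [folklore] -/
theorem exists_negRe_equiv : ∃ τ : ℂ ≃L[ℝ] ℂ, ∀ z, τ z = ⟨-z.re, z.im⟩ := by
  let e : ℂ ≃ₗ[ℝ] ℂ :=
    { toFun := fun z ↦ ⟨-z.re, z.im⟩
      invFun := fun z ↦ ⟨-z.re, z.im⟩
      map_add' := fun z w ↦ Complex.ext (by simp only [add_re]; ring) (by simp)
      map_smul' := fun r z ↦ Complex.ext (by simp) (by simp)
      left_inv := fun z ↦ Complex.ext (by simp) (by simp)
      right_inv := fun z ↦ Complex.ext (by simp) (by simp) }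
  exact ⟨e.toContinuousLinearEquiv, fun z ↦ rfl⟩

end Sigma

/-- A point in the closure of a subset of an open set `P` and in the closure of a set missing
`closure P` lies on the frontier of `P`. [folklore] -/
theorem mem_frontier_of_mem_closure {X : Type*} [TopologicalSpace X] {P U V : Set X}
    (hP : IsOpen P) (hU : U ⊆ P) (hV : V ⊆ (closure P)ᶜ) {z : X} (hzU : z ∈ closure U)
    (hzV : z ∈ closure V) : z ∈ frontier P := by
  rw [hP.frontier_eq]
  refine ⟨closure_mono hU hzU, fun hz ↦ ?_⟩
  obtain ⟨w, hwP, hwV⟩ := mem_closure_iff.1 hzV P hP hz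
  exact hV hwV (subset_closure hwP)

/-- **Grid membership.** If `a`, `b` are grid values for `ξ` at scale `g` (each equals `ξ` once
it is `g`-close to it) and some `x ∈ [a, b]` is `g`-close to `ξ`, then `ξ ∈ [a, b]`.
[folklore] -/
theorem mem_uIcc_of_gap {a b x ξ g : ℝ} (ha : |a - ξ| < g → a = ξ) (hb : |b - ξ| < g → b = ξ)
    (hx : x ∈ uIcc a b) (hxξ : |x - ξ| < g) : ξ ∈ uIcc a b := by
  rw [abs_lt] at hxξ
  rcases le_total a b with hab | hab
  · rw [uIcc_of_le hab] at hx ⊢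
    refine ⟨?_, ?_⟩
    · by_contra hlt
      push Not at hlt
      have := ha (by rw [abs_lt]; constructor <;> linarith [hx.1])
      linarith
    · by_contra hlt
      push Not at hlt
      have := hb (by rw [abs_lt]; constructor <;> linarith [hx.2])
      linarith
  · rw [uIcc_of_ge hab] at hx ⊢
    refine ⟨?_, ?_⟩
    · by_contra hlt
      push Not at hlt
      have := hb (by rw [abs_lt]; constructor <;> linarith [hx.1])
      linarith
    · by_contra hlt
      push Not at hlt
      have := ha (by rw [abs_lt]; constructor <;> linarith [hx.2])
      linarith


/-- A preconnected set meeting an open set `P` and missing its frontier lies in `P` (it lies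
in the union of the disjoint open sets `P` and `(closure P)ᶜ`). [folklore] -/
theorem subset_of_disjoint_frontier {X : Type*} [TopologicalSpace X] {S P : Set X}
    (hS : IsPreconnected S) (hP : IsOpen P) (hf : Disjoint S (frontier P))
    (hne : (S ∩ P).Nonempty) : S ⊆ P := by
  have hsub : S ⊆ P ∪ (closure P)ᶜ := by
    intro z hz
    by_cases hzc : z ∈ closure P
    · rw [closure_eq_self_union_frontier] at hzc
      exact hzc.elim Or.inl (fun hzf ↦ absurd hzf (Set.disjoint_left.1 hf hz))
    · exact Or.inr hzc
  rcases hS.subset_or_subset hP isClosed_closure.isOpen_compl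
    (disjoint_compl_right.mono_left subset_closure) hsub with h1 | h1
  · exact h1
  · obtain ⟨z, hzS, hzP⟩ := hne
    exact absurd (subset_closure hzP) (h1 hzS)

/-- **Grid gap of a finite list of points.** There is `g > 0` such that two abscissae (resp.
ordinates) of points of the list at distance `< g` are equal. [folklore] -/
theorem exists_grid_gap (l : List ℂ) : ∃ g : ℝ, 0 < g ∧
    (∀ (i j : ℕ) (hi : i < l.length) (hj : j < l.length),
      |(l[i]).re - (l[j]).re| < g → (l[i]).re = (l[j]).re) ∧
    (∀ (i j : ℕ) (hi : i < l.length) (hj : j < l.length),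
      |(l[i]).im - (l[j]).im| < g → (l[i]).im = (l[j]).im) := by
  classical
  set D : Finset ℝ := ((Finset.univ : Finset (Fin l.length × Fin l.length)).image
      (fun p ↦ |(l[(p.1 : ℕ)]).re - (l[(p.2 : ℕ)]).re|) ∪
    (Finset.univ : Finset (Fin l.length × Fin l.length)).image
      (fun p ↦ |(l[(p.1 : ℕ)]).im - (l[(p.2 : ℕ)]).im|)).filter (fun d ↦ 0 < d) with hD
  -- a positive lower bound of the positive differences
  obtain ⟨g, hg, hgD⟩ : ∃ g : ℝ, 0 < g ∧ ∀ d ∈ D, g ≤ d := by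
    by_cases hne : D.Nonempty
    · refine ⟨D.min' hne, ?_, fun d hd ↦ D.min'_le d hd⟩
      have hmem : D.min' hne ∈ D := D.min'_mem hne
      have : ∀ d ∈ D, 0 < d := fun d hd ↦ by
        rw [hD, Finset.mem_filter] at hd
        exact hd.2
      exact this _ hmem
    · exact ⟨1, one_pos, fun d hd ↦ absurd ⟨d, hd⟩ hne⟩
  refine ⟨g, hg, fun i j hi hj hlt ↦ ?_, fun i j hi hj hlt ↦ ?_⟩
  · by_contra hne
    have hpos : 0 < |(l[i]).re - (l[j]).re| := abs_pos.2 (sub_ne_zero.2 hne)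
    have hmem : |(l[i]).re - (l[j]).re| ∈ D := by
      rw [hD, Finset.mem_filter, Finset.mem_union]
      exact ⟨Or.inl (Finset.mem_image.2 ⟨(⟨i, hi⟩, ⟨j, hj⟩), Finset.mem_univ _, rfl⟩), hpos⟩
    exact absurd (hgD _ hmem) (not_le.2 hlt)
  · by_contra hne
    have hpos : 0 < |(l[i]).im - (l[j]).im| := abs_pos.2 (sub_ne_zero.2 hne)
    have hmem : |(l[i]).im - (l[j]).im| ∈ D := by
      rw [hD, Finset.mem_filter, Finset.mem_union]
      exact ⟨Or.inr (Finset.mem_image.2 ⟨(⟨i, hi⟩, ⟨j, hj⟩), Finset.mem_univ _, rfl⟩), hpos⟩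
    exact absurd (hgD _ hmem) (not_le.2 hlt)

/-- **Local grid centre.** For finitely many grid values `c i` with gap `g` (two values at
distance `< g` coincide) and any `t`, there is a centre `ξ` near `t` and a radius
`r ≥ |t - ξ| + g / 4` such that no grid value lies in the punctured window
`(ξ - r, ξ + r) ∖ {ξ}`: the nearest grid value if it is `g/4`-close to `t` (with `r = g`),
else `t` itself (with `r = g / 4`). [folklore] -/
theorem exists_local_center {ι : Type*} [Fintype ι] [Nonempty ι] (c : ι → ℝ) {g : ℝ}
    (hg : 0 < g) (hgap : ∀ i j, |c i - c j| < g → c i = c j) (t : ℝ) :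
    ∃ ξ r : ℝ, |t - ξ| + g / 4 ≤ r ∧ ∀ i, c i ∉ Ioo (ξ - r) ξ ∧ c i ∉ Ioo ξ (ξ + r) := by
  obtain ⟨i₀, -, hmin⟩ :=
    Finset.exists_min_image Finset.univ (fun i ↦ |c i - t|) Finset.univ_nonempty
  by_cases hnear : |c i₀ - t| < g / 4
  · refine ⟨c i₀, g, ?_, fun i ↦ ⟨fun hm ↦ ?_, fun hm ↦ ?_⟩⟩
    · rw [abs_sub_comm] at hnear
      linarith
    · have := hgap i i₀ (by rw [abs_lt]; constructor <;> linarith [hm.1, hm.2])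
      linarith [hm.2]
    · have := hgap i i₀ (by rw [abs_lt]; constructor <;> linarith [hm.1, hm.2])
      linarith [hm.1]
  · push Not at hnear
    refine ⟨t, g / 4, by simp, fun i ↦ ⟨fun hm ↦ ?_, fun hm ↦ ?_⟩⟩
    · have h1 := (hnear.trans (hmin i (Finset.mem_univ i)))
      rw [le_abs] at h1
      rcases h1 with h1 | h1 <;> linarith [hm.1, hm.2]
    · have h1 := (hnear.trans (hmin i (Finset.mem_univ i)))
      rw [le_abs] at h1
      rcases h1 with h1 | h1 <;> linarith [hm.1, hm.2]

/-! ### Edges of a simple closed polygon -/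

namespace IsSimpleClosedPolygon

variable {l : List ℂ} (h : IsSimpleClosedPolygon l)

/-- The closed edges of the polygon lie on the frontier of its inside. [folklore] -/
theorem segment_subset_frontier {k : ℕ} (hk : k < l.length) :
    segment ℝ l[k] (l[(k + 1) % l.length]'(Nat.mod_lt _ h.pos)) ⊆
      frontier (polygonDomain l h).carrier := by
  rw [frontier_polygonDomain]
  exact subset_iUnion (fun k : Fin l.length ↦
    segment ℝ (l[(k : ℕ)]) (l[((k : ℕ) + 1) % l.length]'(Nat.mod_lt _ k.pos))) ⟨k, hk⟩

/-- A frontier point of the inside lies on a closed edge. [folklore] -/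
theorem exists_mem_segment_of_mem_frontier {z : ℂ}
    (hz : z ∈ frontier (polygonDomain l h).carrier) :
    ∃ (k : ℕ) (hk : k < l.length),
      z ∈ segment ℝ l[k] (l[(k + 1) % l.length]'(Nat.mod_lt _ h.pos)) := by
  rw [frontier_polygonDomain, mem_iUnion] at hz
  obtain ⟨k, hk⟩ := hz
  exact ⟨k, k.2, hk⟩

/-- The vertices lie on the frontier of the inside. [folklore] -/
theorem getElem_mem_frontier {k : ℕ} (hk : k < l.length) :
    l[k] ∈ frontier (polygonDomain l h).carrier :=
  h.segment_subset_frontier hk (left_mem_segment ℝ _ _)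

/-- **Two distinct closed edges meet only at a vertex that is an endpoint of both** (the
half-open edges are pairwise disjoint). [folklore] -/
theorem eq_or_eq_of_mem_segment {i j : ℕ} (hi : i < l.length) (hj : j < l.length) (hij : i ≠ j)
    {c : ℂ} (hci : c ∈ segment ℝ l[i] (l[(i + 1) % l.length]'(Nat.mod_lt _ h.pos)))
    (hcj : c ∈ segment ℝ l[j] (l[(j + 1) % l.length]'(Nat.mod_lt _ h.pos))) :
    c = l[i] ∨ c = l[(i + 1) % l.length]'(Nat.mod_lt _ h.pos) := by
  rcases mem_icoSegment_or_eq_of_mem_segment hci with hci | hci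
  · rcases mem_icoSegment_or_eq_of_mem_segment hcj with hcj | hcj
    · exact absurd hcj (Set.disjoint_left.1 (h.disjoint i j hi hj hij) hci)
    · left
      have hj1 : (j + 1) % l.length < l.length := Nat.mod_lt _ h.pos
      by_cases hij' : i = (j + 1) % l.length
      · subst hij'
        exact hcj
      · have hc' : c ∈ icoSegment (l[(j + 1) % l.length]'hj1)
            (l[((j + 1) % l.length + 1) % l.length]'(Nat.mod_lt _ h.pos)) :=
          hcj ▸ left_mem_icoSegment _ _
        exact absurd hc' (Set.disjoint_left.1 (h.disjoint i _ hi hj1 hij') hci)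
  · exact Or.inr hci

/-- **A point is an endpoint of at most two edges**: three pairwise distinct edges cannot all
have the point `c` as an endpoint (the vertices are distinct and `k ↦ k + 1` is injective
mod `N`). [folklore] -/
theorem not_endpoint_three {c : ℂ} {i j k : ℕ} (hi : i < l.length) (hj : j < l.length)
    (hk : k < l.length) (hij : i ≠ j) (hjk : j ≠ k) (hik : i ≠ k)
    (hci : c = l[i] ∨ c = l[(i + 1) % l.length]'(Nat.mod_lt _ h.pos))
    (hcj : c = l[j] ∨ c = l[(j + 1) % l.length]'(Nat.mod_lt _ h.pos))
    (hck : c = l[k] ∨ c = l[(k + 1) % l.length]'(Nat.mod_lt _ h.pos)) : False := by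
  -- `k ↦ (k + 1) % N` is injective on `[0, N)`
  have succ_inj : ∀ {a b : ℕ}, a < l.length → b < l.length →
      (a + 1) % l.length = (b + 1) % l.length → a = b := by
    intro a b ha hb hab
    rcases Nat.lt_or_ge (a + 1) l.length with ha1 | ha1 <;>
      rcases Nat.lt_or_ge (b + 1) l.length with hb1 | hb1
    · rw [Nat.mod_eq_of_lt ha1, Nat.mod_eq_of_lt hb1] at hab
      omega
    · have hb2 : b + 1 = l.length := by omega
      rw [Nat.mod_eq_of_lt ha1, hb2, Nat.mod_self] at hab
      omega
    · have ha2 : a + 1 = l.length := by omega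
      rw [Nat.mod_eq_of_lt hb1, ha2, Nat.mod_self] at hab
      omega
    · omega
  obtain ⟨m, hm, hcm⟩ : ∃ (m : ℕ) (hm : m < l.length), c = l[m] := by
    rcases hci with e | e
    · exact ⟨i, hi, e⟩
    · exact ⟨_, Nat.mod_lt _ h.pos, e⟩
  have key : ∀ (e : ℕ) (he : e < l.length),
      (c = l[e] ∨ c = l[(e + 1) % l.length]'(Nat.mod_lt _ h.pos)) →
        e = m ∨ (e + 1) % l.length = m := by
    intro e he hce
    rcases hce with hce | hce
    · refine Or.inl (by_contra fun hne ↦ ?_)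
      exact h.getElem_ne he hm hne (hce.symm.trans hcm)
    · refine Or.inr (by_contra fun hne ↦ ?_)
      exact h.getElem_ne (Nat.mod_lt _ h.pos) hm hne (hce.symm.trans hcm)
  rcases key i hi hci with hi' | hi' <;> rcases key j hj hcj with hj' | hj' <;>
    rcases key k hk hck with hk' | hk'
  · exact hij (hi'.trans hj'.symm)
  · exact hij (hi'.trans hj'.symm)
  · exact hik (hi'.trans hk'.symm)
  · exact hjk (succ_inj hj hk (hj'.trans hk'.symm))
  · exact hjk (hj'.trans hk'.symm)
  · exact hik (succ_inj hi hk (hi'.trans hk'.symm))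
  · exact hij (succ_inj hi hj (hi'.trans hj'.symm))
  · exact hij (succ_inj hi hj (hi'.trans hj'.symm))

/-! ### Rectilinear polygons in `σ`-coordinates -/

section Grid

variable (σ : ℂ ≃L[ℝ] ℂ) {g : ℝ}
  (hrect : ∀ (k : ℕ) (hk : k < l.length),
    (σ l[k]).re = (σ (l[(k + 1) % l.length]'(Nat.mod_lt _ h.pos))).re ∨
    (σ l[k]).im = (σ (l[(k + 1) % l.length]'(Nat.mod_lt _ h.pos))).im)
  (hgre : ∀ (i j : ℕ) (hi : i < l.length) (hj : j < l.length),
    |(σ l[i]).re - (σ l[j]).re| < g → (σ l[i]).re = (σ l[j]).re)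
  (hgim : ∀ (i j : ℕ) (hi : i < l.length) (hj : j < l.length),
    |(σ l[i]).im - (σ l[j]).im| < g → (σ l[i]).im = (σ l[j]).im)

/-- An edge is not both `σ`-vertical and `σ`-horizontal (edges are nondegenerate).
[folklore] -/
theorem not_re_eq_of_im_eq {k : ℕ} (hk : k < l.length)
    (hre : (σ l[k]).re = (σ (l[(k + 1) % l.length]'(Nat.mod_lt _ h.pos))).re)
    (him : (σ l[k]).im = (σ (l[(k + 1) % l.length]'(Nat.mod_lt _ h.pos))).im) : False :=
  h.ne k hk (eq_of_re_im_apply σ hre him)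

include hrect in
/-- **Probe lemma.** For a rectilinear polygon, if `p ∈ A = closure P` and `q ∉ A` have the same
ordinate, some vertex abscissa lies (weakly) between their abscissae and differs from that of
`q`: the segment `[q, p]` carries a frontier point `f ≠ q`, on a vertical edge (abscissa
`= f.re`) or on a horizontal one not containing `q` (an endpoint abscissa lies between).
[folklore] -/
theorem probe {p q : ℂ} (hp : p ∈ closure (polygonDomain l h).carrier)
    (hq : q ∉ closure (polygonDomain l h).carrier) (hpq : (σ p).im = (σ q).im) :
    ∃ (k : ℕ) (hk : k < l.length),
      (σ l[k]).re ∈ uIcc (σ p).re (σ q).re ∧ (σ l[k]).re ≠ (σ q).re := by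
  -- a frontier point `f` on the segment `[q, p]` (it joins the open exterior to `A`)
  obtain ⟨f, hfs, hff⟩ : ∃ f ∈ segment ℝ q p,
      f ∈ frontier (closure (polygonDomain l h).carrier)ᶜ := by
    by_contra hne
    push Not at hne
    have hU : IsOpen (closure (polygonDomain l h).carrier)ᶜ := isClosed_closure.isOpen_compl
    refine (convex_segment q p).isPreconnected.subset_of_closure_inter_subset hU
      ⟨q, left_mem_segment ℝ q p, hq⟩ ?_ (right_mem_segment ℝ q p) hp
    rintro f ⟨hfc, hfT⟩
    by_contra hfU
    exact hne f hfT ⟨hfc, by rwa [hU.interior_eq]⟩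
  rw [frontier_compl] at hff
  have hfP : f ∈ frontier (polygonDomain l h).carrier := frontier_closure_subset hff
  have hfA : f ∈ closure (polygonDomain l h).carrier := frontier_subset_closure hfP
  obtain ⟨hfre, hfim⟩ := re_im_apply_mem_uIcc_of_mem_segment σ hfs
  rw [hpq, uIcc_self, mem_singleton_iff] at hfim
  have hfq : (σ f).re ≠ (σ q).re := fun e ↦ hq (eq_of_re_im_apply σ e hfim ▸ hfA)
  obtain ⟨k, hk, hfk⟩ := h.exists_mem_segment_of_mem_frontier hfP
  obtain ⟨hkre, hkim⟩ := re_im_apply_mem_uIcc_of_mem_segment σ hfk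
  rcases hrect k hk with hv | hh
  · rw [← hv, uIcc_self, mem_singleton_iff] at hkre
    refine ⟨k, hk, ?_, hkre ▸ hfq⟩
    rw [← hkre, uIcc_comm]
    exact hfre
  · rw [← hh, uIcc_self, mem_singleton_iff] at hkim
    have hqk : (σ q).re ∉ uIcc (σ l[k]).re
        (σ (l[(k + 1) % l.length]'(Nat.mod_lt _ h.pos))).re := by
      intro hmem
      refine hq (frontier_subset_closure (h.segment_subset_frontier hk ?_))
      refine mem_segment_of_re_im_apply σ (Or.inr hh) hmem ?_
      rw [← hh, uIcc_self, mem_singleton_iff, ← hfim, hkim]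
    rw [mem_uIcc] at hkre hfre hqk
    push Not at hqk
    rcases hkre with ⟨h1, h2⟩ | ⟨h1, h2⟩
    · by_cases hqa : (σ q).re < (σ l[k]).re
      · refine ⟨k, hk, ?_, hqa.ne'⟩
        rw [mem_uIcc]
        rcases hfre with ⟨h3, h4⟩ | ⟨h3, h4⟩
        · exact Or.inr ⟨hqa.le, by linarith⟩
        · exfalso
          linarith
      · have hqb : (σ (l[(k + 1) % l.length]'(Nat.mod_lt _ h.pos))).re < (σ q).re := by
          by_contra hqb
          exact absurd (hqk.1 (not_lt.1 hqa)) hqb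
        refine ⟨_, Nat.mod_lt _ h.pos, ?_, hqb.ne⟩
        rw [mem_uIcc]
        rcases hfre with ⟨h3, h4⟩ | ⟨h3, h4⟩
        · exfalso
          linarith
        · exact Or.inl ⟨by linarith, hqb.le⟩
    · by_cases hqa : (σ q).re < (σ (l[(k + 1) % l.length]'(Nat.mod_lt _ h.pos))).re
      · refine ⟨_, Nat.mod_lt _ h.pos, ?_, hqa.ne'⟩
        rw [mem_uIcc]
        rcases hfre with ⟨h3, h4⟩ | ⟨h3, h4⟩
        · exact Or.inr ⟨hqa.le, by linarith⟩
        · exfalso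
          linarith
      · have hqb : (σ l[k]).re < (σ q).re := by
          by_contra hqb
          exact absurd (hqk.2 (not_lt.1 hqa)) hqb
        refine ⟨k, hk, ?_, hqb.ne⟩
        rw [mem_uIcc]
        rcases hfre with ⟨h3, h4⟩ | ⟨h3, h4⟩
        · exfalso
          linarith
        · exact Or.inl ⟨by linarith, hqb.le⟩

include hrect in
/-- **Monochromatic boxes.** An open coordinate box whose open sides contain no vertex abscissa,
resp. ordinate, misses the frontier (every edge lies on a vertex abscissa or ordinate line),
hence lies inside the polygon or in the exterior `(closure P)ᶜ`. [folklore] -/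
theorem box_subset_or_subset {a b c d : ℝ}
    (ha : ∀ (i : ℕ) (hi : i < l.length), (σ l[i]).re ∉ Ioo a b)
    (hc : ∀ (i : ℕ) (hi : i < l.length), (σ l[i]).im ∉ Ioo c d) :
    σ ⁻¹' (Ioo a b ×ℂ Ioo c d) ⊆ (polygonDomain l h).carrier ∨
      σ ⁻¹' (Ioo a b ×ℂ Ioo c d) ⊆ (closure (polygonDomain l h).carrier)ᶜ := by
  have hBf : ∀ z ∈ σ ⁻¹' (Ioo a b ×ℂ Ioo c d), z ∉ frontier (polygonDomain l h).carrier := by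
    intro z hz hzf
    obtain ⟨hzre, hzim⟩ := mem_reProdIm.1 hz
    obtain ⟨k, hk, hzk⟩ := h.exists_mem_segment_of_mem_frontier hzf
    obtain ⟨hkre, hkim⟩ := re_im_apply_mem_uIcc_of_mem_segment σ hzk
    rcases hrect k hk with hv | hh
    · rw [← hv, uIcc_self, mem_singleton_iff] at hkre
      exact ha k hk (hkre ▸ hzre)
    · rw [← hh, uIcc_self, mem_singleton_iff] at hkim
      exact hc k hk (hkim ▸ hzim)
  have hsub : σ ⁻¹' (Ioo a b ×ℂ Ioo c d) ⊆
      (polygonDomain l h).carrier ∪ (closure (polygonDomain l h).carrier)ᶜ := by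
    intro z hz
    by_cases hzc : z ∈ closure (polygonDomain l h).carrier
    · rw [closure_eq_self_union_frontier] at hzc
      exact hzc.elim Or.inl (fun hzf ↦ absurd hzf (hBf z hz))
    · exact Or.inr hzc
  exact (isPreconnected_preimage_reProdIm σ (convex_Ioo a b) (convex_Ioo c d)).subset_or_subset
    (polygonDomain l h).isOpen isClosed_closure.isOpen_compl
    (disjoint_compl_right.mono_left subset_closure) hsub

include hrect in
/-- A vertex-free open box meeting `closure P` lies inside the polygon. [folklore] -/
theorem box_subset_of_mem_closure {a b c d : ℝ}
    (ha : ∀ (i : ℕ) (hi : i < l.length), (σ l[i]).re ∉ Ioo a b)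
    (hc : ∀ (i : ℕ) (hi : i < l.length), (σ l[i]).im ∉ Ioo c d) {p : ℂ}
    (hpB : p ∈ σ ⁻¹' (Ioo a b ×ℂ Ioo c d)) (hp : p ∈ closure (polygonDomain l h).carrier) :
    σ ⁻¹' (Ioo a b ×ℂ Ioo c d) ⊆ (polygonDomain l h).carrier :=
  (h.box_subset_or_subset σ hrect ha hc).resolve_right fun hsub ↦ hsub hpB hp

include hrect in
/-- A vertex-free open box containing a point off `closure P` lies off `closure P`.
[folklore] -/
theorem box_subset_compl_of_not_mem {a b c d : ℝ}
    (ha : ∀ (i : ℕ) (hi : i < l.length), (σ l[i]).re ∉ Ioo a b)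
    (hc : ∀ (i : ℕ) (hi : i < l.length), (σ l[i]).im ∉ Ioo c d) {q : ℂ}
    (hqB : q ∈ σ ⁻¹' (Ioo a b ×ℂ Ioo c d)) (hq : q ∉ closure (polygonDomain l h).carrier) :
    σ ⁻¹' (Ioo a b ×ℂ Ioo c d) ⊆ (closure (polygonDomain l h).carrier)ᶜ :=
  (h.box_subset_or_subset σ hrect ha hc).resolve_left fun hsub ↦ hq (subset_closure (hsub hqB))

include hrect hgre in
/-- **Short horizontal segments with ends in `A` lie in `A`.** If `p₀, p₁ ∈ A = closure P` have
the ordinate of `z`, abscissae at distance `< g` (a grid gap) and `z` between them, then `z ∈ A`: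
otherwise the two probes from `p₀` and `p₁` give two distinct vertex abscissae at distance
`< g`. [folklore] -/
theorem mem_closure_of_between {p₀ p₁ z : ℂ} (hp₀ : p₀ ∈ closure (polygonDomain l h).carrier)
    (hp₁ : p₁ ∈ closure (polygonDomain l h).carrier) (h₀ : (σ p₀).im = (σ z).im)
    (h₁ : (σ p₁).im = (σ z).im) (hz : (σ z).re ∈ uIcc (σ p₀).re (σ p₁).re)
    (hd : |(σ p₀).re - (σ p₁).re| < g) : z ∈ closure (polygonDomain l h).carrier := by
  by_contra hzA
  wlog h01 : (σ p₀).re ≤ (σ p₁).re generalizing p₀ p₁ with H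
  · exact H hp₁ hp₀ h₁ h₀ (uIcc_comm (σ p₀).re _ ▸ hz) (abs_sub_comm (σ p₀).re _ ▸ hd)
      (le_of_not_ge h01)
  obtain ⟨i, hi, hiI, hiq⟩ := h.probe σ hrect hp₀ hzA h₀
  obtain ⟨j, hj, hjI, hjq⟩ := h.probe σ hrect hp₁ hzA h₁
  rw [uIcc_of_le h01] at hz
  rw [uIcc_of_le hz.1] at hiI
  rw [uIcc_of_ge hz.2] at hjI
  rw [abs_lt] at hd
  have hij : (σ l[i]).re = (σ l[j]).re :=
    hgre i j hi hj (by rw [abs_lt]; constructor <;> linarith [hiI.1, hiI.2, hjI.1, hjI.2])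
  have h1 : (σ l[i]).re < (σ z).re := lt_of_le_of_ne hiI.2 hiq
  have h2 : (σ z).re < (σ l[j]).re := lt_of_le_of_ne hjI.1 (Ne.symm hjq)
  linarith

include hrect hgre in
/-- A frontier point on the horizontal line through the grid point with `σ`-coordinates
`(ξ, υ)` (`ξ` a vertex abscissa), at horizontal distance `< g` from it and different from it,
lies on a horizontal edge passing through the grid point. [folklore] -/
theorem exists_horizontal_edge {ξ υ : ℝ} (hξ : ∃ (i : ℕ) (hi : i < l.length), (σ l[i]).re = ξ)
    {f : ℂ} (hf : f ∈ frontier (polygonDomain l h).carrier) (hfim : (σ f).im = υ)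
    (hfre : |(σ f).re - ξ| < g) (hfne : (σ f).re ≠ ξ) :
    ∃ (k : ℕ) (hk : k < l.length),
      (σ l[k]).im = (σ (l[(k + 1) % l.length]'(Nat.mod_lt _ h.pos))).im ∧
      σ.symm ⟨ξ, υ⟩ ∈ segment ℝ l[k] (l[(k + 1) % l.length]'(Nat.mod_lt _ h.pos)) ∧
      (σ f).re ∈ uIcc (σ l[k]).re (σ (l[(k + 1) % l.length]'(Nat.mod_lt _ h.pos))).re := by
  obtain ⟨i, hi, hiξ⟩ := hξ
  obtain ⟨k, hk, hfk⟩ := h.exists_mem_segment_of_mem_frontier hf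
  obtain ⟨hkre, hkim⟩ := re_im_apply_mem_uIcc_of_mem_segment σ hfk
  rcases hrect k hk with hv | hh
  · exfalso
    rw [← hv, uIcc_self, mem_singleton_iff] at hkre
    have := hgre k i hk hi (by rw [hiξ, ← hkre]; exact hfre)
    exact hfne (hkre.trans (this.trans hiξ))
  · refine ⟨k, hk, hh, ?_, hkre⟩
    rw [← hh, uIcc_self, mem_singleton_iff] at hkim
    refine mem_segment_of_re_im_apply σ (Or.inr hh) ?_ ?_
    · rw [σ.apply_symm_apply]
      refine mem_uIcc_of_gap (fun h' ↦ (hgre k i hk hi (by rwa [hiξ])).trans hiξ)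
        (fun h' ↦ (hgre _ i (Nat.mod_lt _ h.pos) hi (by rwa [hiξ])).trans hiξ) hkre ?_
      exact hfre
    · rw [σ.apply_symm_apply, ← hh, uIcc_self, mem_singleton_iff, ← hkim, ← hfim]

include hrect hgim in
/-- The transposed statement: a frontier point on the vertical line through the grid point
(`υ` a vertex ordinate), at vertical distance `< g` and different from it, lies on a vertical
edge through the grid point. [folklore] -/
theorem exists_vertical_edge {ξ υ : ℝ} (hυ : ∃ (j : ℕ) (hj : j < l.length), (σ l[j]).im = υ)
    {f : ℂ} (hf : f ∈ frontier (polygonDomain l h).carrier) (hfre : (σ f).re = ξ)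
    (hfim : |(σ f).im - υ| < g) (hfne : (σ f).im ≠ υ) :
    ∃ (k : ℕ) (hk : k < l.length),
      (σ l[k]).re = (σ (l[(k + 1) % l.length]'(Nat.mod_lt _ h.pos))).re ∧
      σ.symm ⟨ξ, υ⟩ ∈ segment ℝ l[k] (l[(k + 1) % l.length]'(Nat.mod_lt _ h.pos)) := by
  obtain ⟨τ, hτ⟩ := exists_swap_equiv
  have hτre : ∀ z, ((σ.trans τ) z).re = (σ z).im := fun z ↦ by
    rw [ContinuousLinearEquiv.trans_apply, hτ]
  have hτim : ∀ z, ((σ.trans τ) z).im = (σ z).re := fun z ↦ by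
    rw [ContinuousLinearEquiv.trans_apply, hτ]
  have hrect' : ∀ (k : ℕ) (hk : k < l.length),
      ((σ.trans τ) l[k]).re = ((σ.trans τ) (l[(k + 1) % l.length]'(Nat.mod_lt _ h.pos))).re ∨
      ((σ.trans τ) l[k]).im = ((σ.trans τ) (l[(k + 1) % l.length]'(Nat.mod_lt _ h.pos))).im :=
    fun k hk ↦ by simpa only [hτre, hτim] using (hrect k hk).symm
  have hgre' : ∀ (i j : ℕ) (hi : i < l.length) (hj : j < l.length),
      |((σ.trans τ) l[i]).re - ((σ.trans τ) l[j]).re| < g →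
        ((σ.trans τ) l[i]).re = ((σ.trans τ) l[j]).re :=
    fun i j hi hj ↦ by simpa only [hτre] using hgim i j hi hj
  have hυ' : ∃ (i : ℕ) (hi : i < l.length), ((σ.trans τ) l[i]).re = υ := by
    simpa only [hτre] using hυ
  obtain ⟨k, hk, hh, hc, -⟩ := h.exists_horizontal_edge (σ.trans τ) hrect' hgre' hυ' hf
    (by rw [hτim, hfre]) (by rwa [hτre]) (by rwa [hτre])
  refine ⟨k, hk, by simpa only [hτim] using hh, ?_⟩
  have e : (σ.trans τ).symm ⟨υ, ξ⟩ = σ.symm ⟨ξ, υ⟩ := by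
    rw [ContinuousLinearEquiv.symm_trans_apply]
    congr 1
    rw [ContinuousLinearEquiv.symm_apply_eq, hτ]
  rwa [e] at hc

include hrect hgre hgim in
/-- **No crosses.** The frontier of the inside of a rectilinear simple polygon contains no cross
of half-size `t < g` centred at a grid point `c` (`σ`-coordinates `(ξ, υ)`, a vertex abscissa
and a vertex ordinate): the four arm tips lie on edges through `c` (horizontal for the east and
west tips, vertical for the other two), `c` is then an endpoint of each of them, a single
horizontal edge cannot reach both sides of its endpoint, and three distinct edges cannot share
an endpoint. [folklore] -/
theorem no_cross {ξ υ t : ℝ} (hξ : ∃ (i : ℕ) (hi : i < l.length), (σ l[i]).re = ξ)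
    (hυ : ∃ (j : ℕ) (hj : j < l.length), (σ l[j]).im = υ) (ht : 0 < t) (htg : t < g)
    (hE : σ.symm ⟨ξ + t, υ⟩ ∈ frontier (polygonDomain l h).carrier)
    (hW : σ.symm ⟨ξ - t, υ⟩ ∈ frontier (polygonDomain l h).carrier)
    (hN : σ.symm ⟨ξ, υ + t⟩ ∈ frontier (polygonDomain l h).carrier)
    (hS : σ.symm ⟨ξ, υ - t⟩ ∈ frontier (polygonDomain l h).carrier) : False := by
  have habs : |t| < g := by rwa [abs_of_pos ht]
  have habs' : |(-t)| < g := by rwa [abs_neg]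
  obtain ⟨kE, hkE, hEh, hcE, hEI⟩ := h.exists_horizontal_edge σ hrect hgre (υ := υ) hξ hE
    (by rw [σ.apply_symm_apply]) (by rw [σ.apply_symm_apply]; simpa using habs)
    (by rw [σ.apply_symm_apply]; simpa using ht.ne')
  obtain ⟨kW, hkW, hWh, hcW, hWI⟩ := h.exists_horizontal_edge σ hrect hgre (υ := υ) hξ hW
    (by rw [σ.apply_symm_apply]) (by rw [σ.apply_symm_apply]; simpa using habs')
    (by rw [σ.apply_symm_apply]; change ξ - t ≠ ξ; simpa using ht.ne')
  obtain ⟨kN, hkN, hNv, hcN⟩ := h.exists_vertical_edge σ hrect hgim (ξ := ξ) hυ hN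
    (by rw [σ.apply_symm_apply]) (by rw [σ.apply_symm_apply]; simpa using habs)
    (by rw [σ.apply_symm_apply]; simpa using ht.ne')
  obtain ⟨kS, hkS, hSv, hcS⟩ := h.exists_vertical_edge σ hrect hgim (ξ := ξ) hυ hS
    (by rw [σ.apply_symm_apply]) (by rw [σ.apply_symm_apply]; simpa using habs')
    (by rw [σ.apply_symm_apply]; change υ - t ≠ υ; simpa using ht.ne')
  have hEN : kE ≠ kN := fun e ↦ by subst e; exact h.not_re_eq_of_im_eq σ hkE hNv hEh
  have hWN : kW ≠ kN := fun e ↦ by subst e; exact h.not_re_eq_of_im_eq σ hkW hNv hWh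
  have hES : kE ≠ kS := fun e ↦ by subst e; exact h.not_re_eq_of_im_eq σ hkE hSv hEh
  have eE := h.eq_or_eq_of_mem_segment hkE hkN hEN hcE hcN
  have eW := h.eq_or_eq_of_mem_segment hkW hkN hWN hcW hcN
  have eN := h.eq_or_eq_of_mem_segment hkN hkE hEN.symm hcN hcE
  by_cases hEW : kE = kW
  · subst hEW
    simp only [ContinuousLinearEquiv.apply_symm_apply] at hEI hWI
    rw [mem_uIcc] at hEI hWI
    rcases eE with e | e
    · have hre : (σ l[kE]).re = ξ := by rw [← e, σ.apply_symm_apply]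
      rw [hre] at hEI hWI
      rcases hEI with ⟨h1, h2⟩ | ⟨h1, h2⟩ <;> rcases hWI with ⟨h3, h4⟩ | ⟨h3, h4⟩ <;> linarith
    · have hre : (σ (l[(kE + 1) % l.length]'(Nat.mod_lt _ h.pos))).re = ξ := by
        rw [← e, σ.apply_symm_apply]
      rw [hre] at hEI hWI
      rcases hEI with ⟨h1, h2⟩ | ⟨h1, h2⟩ <;> rcases hWI with ⟨h3, h4⟩ | ⟨h3, h4⟩ <;> linarith
  · exact h.not_endpoint_three hkE hkW hkN hEW hWN hEN eE eW eN

/-- A point with prescribed `σ`-coordinates in a closed box is in the closure of the open box.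
[folklore] -/
theorem symm_mem_closure_box {a b c d x y : ℝ} (hab : a < b) (hcd : c < d)
    (h1 : a ≤ x) (h2 : x ≤ b) (h3 : c ≤ y) (h4 : y ≤ d) :
    σ.symm ⟨x, y⟩ ∈ closure (σ ⁻¹' (Ioo a b ×ℂ Ioo c d)) :=
  mem_closure_preimage_box σ hab hcd (by rw [σ.apply_symm_apply]; exact h1)
    (by rw [σ.apply_symm_apply]; exact h2) (by rw [σ.apply_symm_apply]; exact h3)
    (by rw [σ.apply_symm_apply]; exact h4)

include hrect hgre hgim in
/-- **No pinch, core form.** At a grid point (`σ`-coordinates `(ξ, υ)`), the four open quadrant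
boxes of size `g` cannot be inside the polygon at NE and SW and outside `closure P` at NW and
SE: the four axis rays from the grid point would then lie on the frontier, a cross
(`no_cross`). [folklore] -/
theorem pinch_core (hg : 0 < g) {ξ υ : ℝ} (hξ : ∃ (i : ℕ) (hi : i < l.length), (σ l[i]).re = ξ)
    (hυ : ∃ (j : ℕ) (hj : j < l.length), (σ l[j]).im = υ)
    (hNE : σ ⁻¹' (Ioo ξ (ξ + g) ×ℂ Ioo υ (υ + g)) ⊆ (polygonDomain l h).carrier)
    (hSW : σ ⁻¹' (Ioo (ξ - g) ξ ×ℂ Ioo (υ - g) υ) ⊆ (polygonDomain l h).carrier)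
    (hNW : σ ⁻¹' (Ioo (ξ - g) ξ ×ℂ Ioo υ (υ + g)) ⊆ (closure (polygonDomain l h).carrier)ᶜ)
    (hSE : σ ⁻¹' (Ioo ξ (ξ + g) ×ℂ Ioo (υ - g) υ) ⊆ (closure (polygonDomain l h).carrier)ᶜ) :
    False := by
  have hP := (polygonDomain l h).isOpen
  have h2 : 0 < g / 2 := half_pos hg
  have hl1 : ξ - g < ξ := by linarith
  have hl2 : ξ < ξ + g := by linarith
  have hl3 : υ - g < υ := by linarith
  have hl4 : υ < υ + g := by linarith
  refine h.no_cross σ hrect hgre hgim hξ hυ h2 (half_lt_self hg) ?_ ?_ ?_ ?_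
  · exact mem_frontier_of_mem_closure hP hNE hSE
      (symm_mem_closure_box σ hl2 hl4 (by linarith) (by linarith) le_rfl (by linarith))
      (symm_mem_closure_box σ hl2 hl3 (by linarith) (by linarith) (by linarith) le_rfl)
  · exact mem_frontier_of_mem_closure hP hSW hNW
      (symm_mem_closure_box σ hl1 hl3 (by linarith) (by linarith) (by linarith) le_rfl)
      (symm_mem_closure_box σ hl1 hl4 (by linarith) (by linarith) le_rfl (by linarith))
  · exact mem_frontier_of_mem_closure hP hNE hNW
      (symm_mem_closure_box σ hl2 hl4 le_rfl (by linarith) (by linarith) (by linarith))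
      (symm_mem_closure_box σ hl1 hl4 (by linarith) le_rfl (by linarith) (by linarith))
  · exact mem_frontier_of_mem_closure hP hSW hSE
      (symm_mem_closure_box σ hl1 hl3 (by linarith) le_rfl (by linarith) (by linarith))
      (symm_mem_closure_box σ hl2 hl3 le_rfl (by linarith) (by linarith) (by linarith))

include hrect hgre hgim in
/-- **Pinch exclusion.** Near a grid point `c` (`σ`-coordinates `(ξ, υ)`, within the grid gap
`g`): if `A = closure P` has a point strictly NE of `c` and a point strictly SW of `c`, then it
cannot miss both a point `q` on the closed W side (`q.re ≤ ξ`) and a point `q'` on the closed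
E side (`q'.re ≥ ξ`). Indeed the NE and SW quadrant boxes are then inside
(`box_subset_or_subset`), their closures lie in `A`, which forces `q` into the open NW box and
`q'` into the open SE box, and these are then exterior: a pinch (`pinch_core`). [folklore] -/
theorem pinch (hg : 0 < g) {ξ υ : ℝ} (hξ : ∃ (i : ℕ) (hi : i < l.length), (σ l[i]).re = ξ)
    (hυ : ∃ (j : ℕ) (hj : j < l.length), (σ l[j]).im = υ) {p p' q q' : ℂ}
    (hp : p ∈ closure (polygonDomain l h).carrier) (hp1 : ξ < (σ p).re)
    (hp2 : (σ p).re < ξ + g) (hp3 : υ < (σ p).im) (hp4 : (σ p).im < υ + g)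
    (hp' : p' ∈ closure (polygonDomain l h).carrier) (hp'1 : ξ - g < (σ p').re)
    (hp'2 : (σ p').re < ξ) (hp'3 : υ - g < (σ p').im) (hp'4 : (σ p').im < υ)
    (hq : q ∉ closure (polygonDomain l h).carrier) (hq1 : ξ - g < (σ q).re)
    (hq2 : (σ q).re ≤ ξ) (hq3 : υ - g < (σ q).im) (hq4 : (σ q).im < υ + g)
    (hq' : q' ∉ closure (polygonDomain l h).carrier) (hq'1 : ξ ≤ (σ q').re)
    (hq'2 : (σ q').re < ξ + g) (hq'3 : υ - g < (σ q').im) (hq'4 : (σ q').im < υ + g) :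
    False := by
  obtain ⟨i, hi, hiξ⟩ := hξ
  obtain ⟨j, hj, hjυ⟩ := hυ
  have hl1 : ξ - g < ξ := by linarith
  have hl2 : ξ < ξ + g := by linarith
  have hl3 : υ - g < υ := by linarith
  have hl4 : υ < υ + g := by linarith
  -- no vertex coordinate strictly inside the four half-windows
  have hreE : ∀ (k : ℕ) (hk : k < l.length), (σ l[k]).re ∉ Ioo ξ (ξ + g) := fun k hk hm ↦ by
    have := hgre k i hk hi (by rw [hiξ, abs_lt]; constructor <;> linarith [hm.1, hm.2])
    linarith [hm.1]
  have hreW : ∀ (k : ℕ) (hk : k < l.length), (σ l[k]).re ∉ Ioo (ξ - g) ξ := fun k hk hm ↦ by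
    have := hgre k i hk hi (by rw [hiξ, abs_lt]; constructor <;> linarith [hm.1, hm.2])
    linarith [hm.2]
  have himN : ∀ (k : ℕ) (hk : k < l.length), (σ l[k]).im ∉ Ioo υ (υ + g) := fun k hk hm ↦ by
    have := hgim k j hk hj (by rw [hjυ, abs_lt]; constructor <;> linarith [hm.1, hm.2])
    linarith [hm.1]
  have himS : ∀ (k : ℕ) (hk : k < l.length), (σ l[k]).im ∉ Ioo (υ - g) υ := fun k hk hm ↦ by
    have := hgim k j hk hj (by rw [hjυ, abs_lt]; constructor <;> linarith [hm.1, hm.2])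
    linarith [hm.2]
  have hNE := (h.box_subset_or_subset σ hrect hreE himN).resolve_right
    (fun hsub ↦ hsub (show p ∈ _ from mem_reProdIm.2 ⟨⟨hp1, hp2⟩, ⟨hp3, hp4⟩⟩) hp)
  have hSW := (h.box_subset_or_subset σ hrect hreW himS).resolve_right
    (fun hsub ↦ hsub (show p' ∈ _ from mem_reProdIm.2 ⟨⟨hp'1, hp'2⟩, ⟨hp'3, hp'4⟩⟩) hp')
  -- `q` is strictly NW, `q'` strictly SE
  have hqim : υ < (σ q).im := by
    by_contra hle
    push Not at hle
    exact hq (closure_mono hSW (mem_closure_preimage_box σ hl1 hl3 hq1.le hq2 hq3.le hle))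
  have hqre : (σ q).re < ξ := by
    rcases hq2.lt_or_eq with hlt | heq
    · exact hlt
    · exact absurd (closure_mono hNE
        (mem_closure_preimage_box σ hl2 hl4 heq.ge (by linarith) hqim.le hq4.le)) hq
  have hq'im : (σ q').im < υ := by
    by_contra hle
    push Not at hle
    exact hq' (closure_mono hNE (mem_closure_preimage_box σ hl2 hl4 hq'1 hq'2.le hle hq'4.le))
  have hq're : ξ < (σ q').re := by
    rcases hq'1.lt_or_eq with hlt | heq
    · exact hlt
    · exact absurd (closure_mono hSW
        (mem_closure_preimage_box σ hl1 hl3 (by linarith) heq.ge hq'3.le hq'im.le)) hq'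
  have hNW := (h.box_subset_or_subset σ hrect hreW himN).resolve_left
    (fun hsub ↦ hq (subset_closure (hsub (mem_reProdIm.2 ⟨⟨hq1, hqre⟩, ⟨hqim, hq4⟩⟩))))
  have hSE := (h.box_subset_or_subset σ hrect hreE himS).resolve_left
    (fun hsub ↦ hq' (subset_closure (hsub (mem_reProdIm.2 ⟨⟨hq're, hq'2⟩, ⟨hq'3, hq'im⟩⟩))))
  exact h.pinch_core σ hrect hgre hgim hg ⟨i, hi, hiξ⟩ ⟨j, hj, hjυ⟩ hNE hSW hNW hSE

end Grid

end IsSimpleClosedPolygon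

end Literature.Probability.RandomPlanarGeometry
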